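import Mathlib
import HarnessLib
import Literature.Analysis.FluidPDE.ClassicalSolution
import Literature.Analysis.FluidPDE.VectorCalculus
import Summits.NavierStokesRegularity.NavierStokesRegularity.Theorems.UnthreadedRigidityDoorUnthreadedRigidityProfileHornZonalAxis
import Summits.NavierStokesRegularity.NavierStokesRegularity.Theorems.UnthreadedRigidityDoorUnthreadedRigidityPressureHornDefs

/-!
# Route `UnthreadedRigidityDoor`, item `UnthreadedRigidity` (W2, stmt-NavierStokesRegularity-27585) — LINE g10-1 «PRESSURE HORN»: the three
# «provable now» SUPPORTS S-E `EulerVanishing`, S-T `FiniteTowerWedge`, S-Z′ `ZonalSepShellAxisym` (sorry-free) + `isoShell_eq_sepShell`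

Cell ns-regularity-ideate, K2 hand ns-poloidal-K2-p2 g13 (DIRECTOR-NS KEY-NS #186 / #281); statements = the Props of the Theorems-side twin
`…Theorems.UnthreadedRigidity.PressureHorn` (`UnthreadedRigidityDoorUnthreadedRigidityPressureHornDefs.lean`, bodies VERBATIM from planner ns-idea-6 g10's
`PressureHorn_sketch.lean` v1.1).

* `eulerVanishing_holds : EulerVanishing` (S-E) — if `d/dr(r⁶·w(r)) = 0` on `(0,∞)` for the wedge `w(r) = det[y, Q(r)y, Q′(r)y]` of an ADMISSIBLE family
  (`Q(r) = q(r²)`, `q` entrywise smooth), then `w ≡ 0` on `(0,∞)`: on `(0,∞)` the function `r⁶w` agrees with the globally differentiable model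
  `G(r) = r⁶·det[y, q(r²)y, (q(r²))′y]`, the mean value theorem makes `G` constant on `(0,∞)`, continuity at `0` gives the constant `G(0) = 0`.
* `finiteTowerWedge_holds : FiniteTowerWedge` (S-T) — a finite tower `Q = Σ_k H_k • Q_k` with pairwise disjoint open radial supports is piecewise
  separable: inside the support of piece `k` one has `Q = H_k • Q_k` NEAR `r`, so `Q′(r) = H_k′(r) • Q_k` and `det[y, Qy, Q′y]` has proportional columns;
  off every open support `Q(r) = 0`.
* `zonalSepShellAxisym_holds : ZonalSepShellAxisym` (S-Z′) — from g10-2's landed UNIFORM version `…ProfileHorn.zonalSepShellAxisymUniform_holds` (p690562,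
  ns-crc-p1 g7): the uniform generator serves each profile.

HONEST LABEL: three S-sized supports of one line on the wall item; the bridges (`IsotypicOrderOneIdentity`, `WindowWedgeAnalytic`, `HornWindowSilenceVar`),
`AnalyticWedgeSeparable`, `WindowAxisUniform`, the crux `NestedHornExclusion(Finite)` are NOT touched here; ⟨27585⟩ / W2 OPEN; NS regularity NOT proved.
-/

noncomputable section

-- the summit and its single sub-problem share the name (CONVENTIONS §1), as in every Theorems file
set_option linter.dupNamespace false

namespace Summit.NavierStokesRegularity.NavierStokesRegularity.Theorems.UnthreadedRigidity.PressureHorn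

open Set Function Filter Topology
open Summit.NavierStokesRegularity.NavierStokesRegularity.Theorems.UnthreadedRigidity.ProfileHorn

/-! ## Algebra of the wedge cubic -/

/-- The wedge cubic expanded (rows `y`, `Ay`, `By`). -/
theorem wedgeDet_eq (A B : Matrix (Fin 3) (Fin 3) ℝ) (y : E3) :
    wedgeDet A B y =
      y 0 * (A.mulVec (fun i => y i)) 1 * (B.mulVec (fun i => y i)) 2 - y 0 * (A.mulVec (fun i => y i)) 2 * (B.mulVec (fun i => y i)) 1
        - y 1 * (A.mulVec (fun i => y i)) 0 * (B.mulVec (fun i => y i)) 2 + y 1 * (A.mulVec (fun i => y i)) 2 * (B.mulVec (fun i => y i)) 0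
        + y 2 * (A.mulVec (fun i => y i)) 0 * (B.mulVec (fun i => y i)) 1 - y 2 * (A.mulVec (fun i => y i)) 1 * (B.mulVec (fun i => y i)) 0 := by
  unfold wedgeDet
  rw [det_rows_three]

/-- Proportional second and third rows: `det[y, (cM)y, (dM)y] = 0`. -/
theorem wedgeDet_smul_smul (M : Matrix (Fin 3) (Fin 3) ℝ) (c d : ℝ) (y : E3) : wedgeDet (c • M) (d • M) y = 0 := by
  rw [wedgeDet_eq, Matrix.smul_mulVec, Matrix.smul_mulVec]
  simp only [Pi.smul_apply, smul_eq_mul]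
  ring

/-- A vanishing second row: `det[y, 0, By] = 0`. -/
theorem wedgeDet_zero_left (B : Matrix (Fin 3) (Fin 3) ℝ) (y : E3) : wedgeDet 0 B y = 0 := by
  rw [wedgeDet_eq, Matrix.zero_mulVec]
  simp only [Pi.zero_apply]
  ring

/-- Homogeneity of the wedge cubic: `w(t•y) = t³ w(y)`. -/
theorem wedgeDet_smul_arg (A B : Matrix (Fin 3) (Fin 3) ℝ) (t : ℝ) (y : E3) :
    wedgeDet A B (t • y) = t ^ 3 * wedgeDet A B y := by
  have h0 : (fun i => (t • y) i) = t • (fun i => y i) := by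
    funext i; simp
  unfold wedgeDet
  rw [h0, Matrix.mulVec_smul, Matrix.mulVec_smul, det_rows_three, det_rows_three]
  simp only [Pi.smul_apply, smul_eq_mul]
  ring

/-- Vanishing on the unit sphere is vanishing everywhere (homogeneity). -/
theorem wedgeDet_eq_zero_of_sphere {A B : Matrix (Fin 3) (Fin 3) ℝ} (h : ∀ y : E3, ‖y‖ = 1 → wedgeDet A B y = 0) (y : E3) :
    wedgeDet A B y = 0 := by
  by_cases hy : y = 0
  · have : y = (0 : ℝ) • y := by rw [hy, smul_zero]
    rw [this, wedgeDet_smul_arg]; ring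
  · have hn : ‖y‖ ≠ 0 := norm_ne_zero_iff.mpr hy
    have hu : ‖(‖y‖⁻¹ • y)‖ = 1 := by rw [norm_smul, norm_inv, norm_norm, inv_mul_cancel₀ hn]
    have e : y = ‖y‖ • (‖y‖⁻¹ • y) := by rw [smul_smul, mul_inv_cancel₀ hn, one_smul]
    rw [e, wedgeDet_smul_arg, h _ hu, mul_zero]

/-- The wedge cubic of two ENTRYWISE-DIFFERENTIABLE matrix families is differentiable in the parameter. -/
theorem differentiable_wedgeDet_family {a b : Fin 3 → Fin 3 → ℝ → ℝ} (ha : ∀ i j, Differentiable ℝ (a i j))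
    (hb : ∀ i j, Differentiable ℝ (b i j)) (y : E3) :
    Differentiable ℝ fun s => wedgeDet (Matrix.of fun i j => a i j s) (Matrix.of fun i j => b i j s) y := by
  have hA : ∀ i, Differentiable ℝ fun s => ((Matrix.of fun i j => a i j s).mulVec (fun i => y i)) i := by
    intro i
    simp only [Matrix.mulVec, dotProduct, Matrix.of_apply]
    fun_prop
  have hB : ∀ i, Differentiable ℝ fun s => ((Matrix.of fun i j => b i j s).mulVec (fun i => y i)) i := by
    intro i
    simp only [Matrix.mulVec, dotProduct, Matrix.of_apply]
    fun_prop
  simp only [wedgeDet_eq]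
  fun_prop

/-! ## S-E — the Euler ODE support -/

/-- **S-E `EulerVanishing` holds**: `d/dr(r⁶ w) = 0` on `(0,∞)` for the wedge `w` of an admissible family forces `w ≡ 0` on `(0,∞)`. -/
theorem eulerVanishing_holds : EulerVanishing := by
  intro Q y hQa hder r hr
  obtain ⟨-, ⟨q, hq, hQq⟩, -⟩ := hQa
  -- smooth global models of the entries and of their radial derivatives
  set qe : Fin 3 → Fin 3 → ℝ → ℝ := fun i j s => q (s ^ 2) i j with hqe_def
  have hqe : ∀ i j, ContDiff ℝ (⊤ : ℕ∞) (qe i j) := fun i j => (hq i j).comp (contDiff_id.pow 2)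
  have hqed : ∀ i j, Differentiable ℝ (qe i j) := fun i j => (hqe i j).differentiable (by simp)
  set de : Fin 3 → Fin 3 → ℝ → ℝ := fun i j s => deriv (qe i j) s with hde_def
  have hded : ∀ i j, Differentiable ℝ (de i j) := by
    intro i j
    have h := (hqe i j).iterate_deriv 1
    simp only [Function.iterate_one] at h
    exact (h : ContDiff ℝ (⊤ : ℕ∞) (deriv (qe i j))).differentiable (by simp)
  -- on `(0,∞)` the family and its radial derivative agree with the models
  have hQe : ∀ s : ℝ, 0 < s → ∀ i j, Q s i j = qe i j s := fun s hs i j => by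
    show Q s i j = q (s ^ 2) i j
    rw [hQq s hs.le]
  have hDe : ∀ s : ℝ, 0 < s → ∀ i j, radDeriv Q s i j = de i j s := by
    intro s hs i j
    simp only [radDeriv, Matrix.of_apply, hde_def]
    refine Filter.EventuallyEq.deriv_eq ?_
    filter_upwards [Ioi_mem_nhds hs] with s' hs'
    exact hQe s' hs' i j
  -- the differentiable model `G(s) = s⁶ · W(s)` of `s⁶ w(s)`
  set W : ℝ → ℝ := fun s => wedgeDet (Matrix.of fun i j => qe i j s) (Matrix.of fun i j => de i j s) y with hW_def
  have hWw : ∀ s : ℝ, 0 < s → wedgeDet (Q s) (radDeriv Q s) y = W s := by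
    intro s hs
    have hQs : Q s = Matrix.of fun i j => qe i j s := by
      ext i j; rw [Matrix.of_apply]; exact hQe s hs i j
    have hDs : radDeriv Q s = Matrix.of fun i j => de i j s := by
      ext i j; rw [Matrix.of_apply]; exact hDe s hs i j
    rw [hQs, hDs]
  have hWd : Differentiable ℝ W := differentiable_wedgeDet_family hqed hded y
  set G : ℝ → ℝ := fun s => s ^ 6 * W s with hG_def
  have hGd : Differentiable ℝ G := (differentiable_id.pow 6).mul hWd
  have hGder : ∀ s : ℝ, 0 < s → deriv G s = 0 := by
    intro s hs
    have hev : (fun s' => s' ^ 6 * wedgeDet (Q s') (radDeriv Q s') y) =ᶠ[𝓝 s] G := by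
      filter_upwards [Ioi_mem_nhds hs] with s' hs'
      show s' ^ 6 * wedgeDet (Q s') (radDeriv Q s') y = s' ^ 6 * W s'
      rw [hWw s' hs']
    rw [← hev.deriv_eq]
    exact hder s hs
  -- `G` is constant on `(0,∞)` (mean value theorem) ...
  have hconst : ∀ a b : ℝ, 0 < a → a < b → G b = G a := by
    intro a b ha hab
    obtain ⟨c, hc, hcder⟩ := exists_deriv_eq_slope G hab hGd.continuous.continuousOn (hGd.differentiableOn)
    rw [hGder c (ha.trans hc.1)] at hcder
    have hba : b - a ≠ 0 := sub_ne_zero.2 hab.ne'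
    have := hcder.symm
    rw [div_eq_zero_iff] at this
    rcases this with h | h
    · linarith [sub_eq_zero.1 h]
    · exact absurd h hba
  -- ... and continuous at `0`, where it vanishes
  have hG0 : G 0 = 0 := by
    show (0 : ℝ) ^ 6 * W 0 = 0
    simp
  have hGr : G r = 0 := by
    have h1 : Tendsto G (𝓝[>] (0 : ℝ)) (𝓝 (G 0)) := hGd.continuous.continuousAt.tendsto.mono_left nhdsWithin_le_nhds
    have h2 : Tendsto G (𝓝[>] (0 : ℝ)) (𝓝 (G r)) := by
      have hev : (fun _ => G r) =ᶠ[𝓝[>] (0 : ℝ)] G := by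
        filter_upwards [Ioo_mem_nhdsGT hr] with s hs
        exact hconst s r hs.1 hs.2
      exact Tendsto.congr' hev tendsto_const_nhds
    rw [tendsto_nhds_unique h2 h1, hG0]
  have hWr : W r = 0 := by
    have h6 : r ^ 6 ≠ 0 := pow_ne_zero 6 hr.ne'
    have : r ^ 6 * W r = 0 := hGr
    rcases mul_eq_zero.1 this with h | h
    · exact absurd h h6
    · exact h
  rw [hWw r hr, hWr]

/-! ## S-T — a finite tower is piecewise separable -/

/-- **S-T `FiniteTowerWedge` holds**: a finite tower with pairwise disjoint open radial supports has vanishing wedge. -/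
theorem finiteTowerWedge_holds : FiniteTowerWedge := by
  intro Q _ hT r hr y _
  obtain ⟨N, Hk, Qk, a, b, hk, hdisj, hoff, hsum⟩ := hT
  by_cases hin : ∃ k, a k < r ∧ r < b k
  · obtain ⟨k, hak, hbk⟩ := hin
    -- near `r` only piece `k` is present
    have hev : ∀ᶠ s in 𝓝 r, Q s = Hk k s • Qk k := by
      filter_upwards [Ioo_mem_nhds hak hbk] with s hs
      have hs0 : 0 ≤ s := (hk k).2.2.1.trans hs.1.le
      rw [hsum s hs0, Finset.sum_eq_single k]
      · intro j _ hj
        rcases hdisj j k hj with h | h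
        · rw [hoff j s hs0 (Or.inr (h.trans hs.1.le)), zero_smul]
        · rw [hoff j s hs0 (Or.inl (hs.2.le.trans h)), zero_smul]
      · intro h; exact absurd (Finset.mem_univ k) h
    have hQr : Q r = Hk k r • Qk k := hev.self_of_nhds
    have hD : radDeriv Q r = deriv (Hk k) r • Qk k := by
      ext i j
      simp only [radDeriv, Matrix.of_apply, Matrix.smul_apply, smul_eq_mul]
      have h1 : (fun s => Q s i j) =ᶠ[𝓝 r] fun s => Hk k s * Qk k i j := by
        filter_upwards [hev] with s hs
        rw [hs, Matrix.smul_apply, smul_eq_mul]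
      rw [h1.deriv_eq, deriv_mul_const_field]
    rw [hQr, hD]
    exact wedgeDet_smul_smul (Qk k) _ _ y
  · push Not at hin
    have hQr : Q r = 0 := by
      rw [hsum r hr.le]
      refine Finset.sum_eq_zero fun k _ => ?_
      have hk' : r ≤ a k ∨ b k ≤ r := by
        by_cases h : r ≤ a k
        · exact Or.inl h
        · exact Or.inr (hin k (lt_of_not_ge h))
      rw [hoff k r hr.le hk', zero_smul]
    rw [hQr]
    exact wedgeDet_zero_left _ y

/-! ## Separable families generate separable shells -/

/-- `Y_{cQ} = c·Y_Q`. -/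
theorem quadY_smul (c : ℝ) (Q : Matrix (Fin 3) (Fin 3) ℝ) (y : E3) : quadY (c • Q) y = c * quadY Q y := by
  simp only [quadY, Matrix.smul_apply, smul_eq_mul, Finset.mul_sum]
  refine Finset.sum_congr rfl (fun i _ => Finset.sum_congr rfl (fun j _ => ?_))
  ring

/-- A separable family generates the separable shell: `isoShell (r ↦ H(r)•Q₀) x₀ = sepShell H Q₀ x₀`. -/
theorem isoShell_eq_sepShell {Q : ℝ → Matrix (Fin 3) (Fin 3) ℝ} {H : ℝ → ℝ} {Q₀ : Matrix (Fin 3) (Fin 3) ℝ} (x₀ : E3)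
    (h : ∀ r : ℝ, 0 ≤ r → Q r = H r • Q₀) : isoShell Q x₀ = sepShell H Q₀ x₀ := by
  have hfg : (fun x : E3 => (quadY (Q ‖x - x₀‖) (x - x₀)) • (x - x₀))
      = (fun x : E3 => (H ‖x - x₀‖ * quadY Q₀ (x - x₀)) • (x - x₀)) := by
    funext x
    rw [h ‖x - x₀‖ (norm_nonneg _), quadY_smul]
  unfold isoShell sepShell
  rw [hfg]

/-! ## S-Z′ — zonal separable shells are axisymmetric slices -/

/-- **S-Z′ `ZonalSepShellAxisym` holds** — the landed uniform version `…ProfileHorn.zonalSepShellAxisymUniform_holds` (LINE g10-2, p690562) specialised to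
one profile. -/
theorem zonalSepShellAxisym_holds : ZonalSepShellAxisym := by
  intro Q H x₀ hQ hz hH
  obtain ⟨A, hskew, hne, hA⟩ := zonalSepShellAxisymUniform_holds Q hQ hz
  exact ⟨A, hskew, hne, fun x => hA H x₀ hH x⟩

end Summit.NavierStokesRegularity.NavierStokesRegularity.Theorems.UnthreadedRigidity.PressureHorn

end
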